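import Literature.AlgebraicGeometry.Resolution.RegularLocalRingsJacobian
import Mathlib.RingTheory.Henselian
import Mathlib.FieldTheory.IsSepClosed
import Mathlib.AlgebraicGeometry.Morphisms.Proper
import HarnessLib

/-!
# SUPPORT statements of the idea card `regular-model-centres` of `res-L1-w45b-idea-1` (crux `EquisingularLift`, honest
# variant EL♮ = `EquisingularLiftNat`, stmt-ResolutionOfSingularities-20038): regular mod a regular parameter, quotient by a
# square-class element, and the Hensel two-sheet splitting of a Q-form

[OURS · L W4.5 (b)] Helper for the idea card `regular-model-centres` (v3; res-L1-w45b-tri-1 TRIAGE v2.1 «SURVIVES») of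
`res-L1-w45b-idea-1` (`Cruxes/EquisingularLift/Ideas/`, Sketch `HOME/L/res-L1-w45b-idea-1/Sketch-L1-idea-1.lean` v4, §4.4 / §5.2 / §5.3:
the `Prop`s `RegularModRegularParameter`, `TwoSheetSplitting`, `QuotBySquareClassNotRegular`, `BinaryQuadricHasZero`, and §3 `ProperSpecialisationMeets`, typed there as `def … : Prop` SUPPORT
statements without proof). NOT statements of the manuscript under review (Hironaka 2017); nothing here is attributed to its author.
Each theorem below has as its TYPE the body of the Sketch's `def` VERBATIM (so `theorem … : <Sketch def> := …` would be `Iff.rfl`-equal);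
no `def` is introduced here.

* `regularModRegularParameter` — a regular local ring modulo `a ∈ 𝔪 ∖ 𝔪²` is regular local (tree: Matsumura 14.2,
  `IsRegularLocalRing.quotient_span_singleton`; Bruns–Herzog 2.2.4 / Stacks 00NR as cited by the card).
* `quotBySquareClassNotRegular` — a regular local ring modulo `0 ≠ a ∈ 𝔪²` is NOT regular (tree: Matsumura 14.2 read backwards,
  `not_isRegularLocalRing_quotient_span_singleton_of_mem_sq`).
* `twoSheetSplitting` — Hensel: in a henselian local ring with separably closed residue field, a Q-form `A u² + B uF + F²` with
  `A` and `B² − 4A` units splits as `A (u − ρ₁F)(u − ρ₂F)` with `ρ₁ − ρ₂` a unit (res-L1-w45b-tri-2 NOTES g3: «two-sheet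
  factorisation lemma (Hensel) as Negative-lane toolkit»). Proof: `ρ₁, ρ₂` are the roots of the monic `T² + (B/A)T + 1/A`, whose
  discriminant `(B² − 4A)/A²` is a unit; the reduction is separable (`4f − f'² = −disc`), so it has a root in the separably closed
  residue field (`IsSepClosed.exists_root`), which lifts (`HenselianLocalRing.is_henselian`) to a root `ρ₁` with `f'(ρ₁)` a unit;
  `ρ₂ := −B/A − ρ₁` and `ρ₁ − ρ₂ = f'(ρ₁)`.
* `binaryQuadricHasZero` (§5.3, global half) — a binary quadratic form over an algebraically closed field has a non-trivial zero.
* `properSpecialisationMeets` (§3 INCIDENCE RULE, used by both of idea-1's round-1 cards) — a closed subset of a proper `O`-scheme,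
  `O` a DVR, with a point over the generic point has a point over the closed point (proper ⇒ universally closed ⇒ the image is
  closed and contains the generic point of `Spec O`, whose closure is everything).

AI-written; AI review is weaker than expert review.
-/

set_option linter.dupNamespace false

noncomputable section

namespace Summit.ResolutionOfSingularities.ResolutionOfSingularities.Theorems.EquisingularLift.RegularModelCentres

open IsLocalRing Polynomial

/-- **§4.4 SUPPORT (Sketch `RegularModRegularParameter`, body VERBATIM).** A regular local ring modulo an element of `𝔪 ∖ 𝔪²`
is regular local. OURS (tree `IsRegularLocalRing.quotient_span_singleton`, Matsumura 14.2). -/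
theorem regularModRegularParameter :
    ∀ (R : Type) [CommRing R] [IsRegularLocalRing R] (a : R),
      a ∈ maximalIdeal R → a ∉ (maximalIdeal R) ^ 2 → IsRegularLocalRing (R ⧸ Ideal.span {a}) :=
  fun _ _ _ _ ha ha2 => (Literature.AlgebraicGeometry.Resolution.IsRegularLocalRing.quotient_span_singleton ha ha2).1

/-- **§5.3 SUPPORT (Sketch `QuotBySquareClassNotRegular`, body VERBATIM).** A regular local ring modulo one non-zero element of
`𝔪²` is not regular. OURS (tree `not_isRegularLocalRing_quotient_span_singleton_of_mem_sq`, Matsumura 14.2). -/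
theorem quotBySquareClassNotRegular :
    ∀ (R : Type) [CommRing R] [IsRegularLocalRing R] (a : R), a ≠ 0 → a ∈ (maximalIdeal R) ^ 2 →
      ¬ IsRegularLocalRing (R ⧸ Ideal.span {a}) :=
  fun _ _ _ _ ha0 ha2 =>
    Literature.AlgebraicGeometry.Resolution.not_isRegularLocalRing_quotient_span_singleton_of_mem_sq ha0 ha2

/-- A monic quadratic `T² + bT + c` whose discriminant `b² − 4c` is a unit is separable: `4·f − f'·f' = 4c − b²`. OURS. -/
theorem separable_quadratic_of_isUnit_disc {K : Type*} [CommRing K] (b c : K) (hD : IsUnit (b ^ 2 - 4 * c)) :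
    (X ^ 2 + C b * X + C c : K[X]).Separable := by
  obtain ⟨d, hd⟩ := hD
  rw [Polynomial.separable_def]
  have hder : derivative (X ^ 2 + C b * X + C c : K[X]) = 2 * X + C b := by
    simp only [derivative_add, derivative_X_pow, derivative_mul, derivative_C, derivative_X, zero_mul, mul_one,
      zero_add, add_zero, Nat.cast_ofNat, Nat.add_one_sub_one, pow_one, map_ofNat]
  rw [hder]
  refine ⟨C (-(4 : K) * ↑d⁻¹), C (↑d⁻¹ : K) * (2 * X + C b), ?_⟩
  have key : (C (-(4 : K)) * (X ^ 2 + C b * X + C c) + (2 * X + C b) * (2 * X + C b) : K[X]) = C (b ^ 2 - 4 * c) := by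
    simp only [map_sub, map_mul, map_pow, map_neg, map_ofNat]
    ring
  calc C (-(4 : K) * ↑d⁻¹) * (X ^ 2 + C b * X + C c) + C (↑d⁻¹ : K) * (2 * X + C b) * (2 * X + C b)
      = C (↑d⁻¹ : K) * (C (-(4 : K)) * (X ^ 2 + C b * X + C c) + (2 * X + C b) * (2 * X + C b)) := by
        simp only [map_mul, map_neg]; ring
    _ = 1 := by rw [key, ← hd, ← map_mul, Units.inv_mul, map_one]

/-- **§5.2 SUPPORT (Sketch `TwoSheetSplitting`, body VERBATIM): Hensel two-sheet splitting of a Q-form.** OURS. -/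
theorem twoSheetSplitting :
    ∀ (R : Type) [CommRing R] [HenselianLocalRing R], IsSepClosed (IsLocalRing.ResidueField R) →
      ∀ A B : R, IsUnit A → IsUnit (B ^ 2 - 4 * A) →
        ∃ ρ₁ ρ₂ : R, (∀ u F : R, A * u ^ 2 + B * u * F + F ^ 2 = A * (u - ρ₁ * F) * (u - ρ₂ * F)) ∧ IsUnit (ρ₁ - ρ₂) := by
  intro R _ _ hsc A B hA hD
  haveI := hsc
  obtain ⟨α, rfl⟩ := hA
  -- the monic quadratic `f = T² + bT + c`, `b = B/A`, `c = 1/A`, with unit discriminant `b² − 4c = (B² − 4A)/A²`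
  have hαinv : (↑α : R) * ↑α⁻¹ = 1 := Units.mul_inv α
  have hDu : IsUnit ((B * ↑α⁻¹) ^ 2 - 4 * ↑α⁻¹ : R) := by
    have hdisc : ((B * ↑α⁻¹) ^ 2 - 4 * ↑α⁻¹ : R) = (B ^ 2 - 4 * ↑α) * ↑α⁻¹ ^ 2 := by
      linear_combination (4 : R) * ↑α⁻¹ * hαinv
    rw [hdisc]; exact hD.mul ((Units.isUnit α⁻¹).pow 2)
  obtain ⟨f, hf⟩ : ∃ f : R[X], f = C 1 * X ^ 2 + C (B * ↑α⁻¹) * X + C (↑α⁻¹ : R) := ⟨_, rfl⟩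
  have hfm : f.Monic := by
    rw [Monic, hf, leadingCoeff_quadratic one_ne_zero]
  have hfeval : ∀ t : R, f.eval t = t ^ 2 + B * ↑α⁻¹ * t + ↑α⁻¹ := fun t => by
    simp only [hf, eval_add, eval_mul, eval_C, eval_pow, eval_X, one_mul]
  have hf' : derivative f = 2 * X + C (B * ↑α⁻¹) := by
    rw [hf]
    simp only [map_one, one_mul, derivative_add, derivative_mul, derivative_X_pow, derivative_C, derivative_X,
      zero_mul, mul_one, zero_add, add_zero, Nat.cast_ofNat, Nat.add_one_sub_one, pow_one, map_ofNat]
  have hfder : ∀ t : R, f.derivative.eval t = 2 * t + B * ↑α⁻¹ := fun t => by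
    rw [hf']
    simp only [eval_add, eval_mul, eval_X, eval_C, eval_ofNat]
  -- the reduction `f̄` over the separably closed residue field is a separable quadratic: it has a root
  have hmap : f.map (IsLocalRing.residue R) =
      X ^ 2 + C (IsLocalRing.residue R (B * ↑α⁻¹)) * X + C (IsLocalRing.residue R ↑α⁻¹) := by
    simp only [hf, map_one, one_mul, Polynomial.map_add, Polynomial.map_mul, Polynomial.map_pow, map_X, map_C]
  have hsep : (f.map (IsLocalRing.residue R)).Separable := by
    rw [hmap]
    apply separable_quadratic_of_isUnit_disc
    have h := hDu.map (IsLocalRing.residue R)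
    simp only [map_sub, map_pow, map_mul, map_ofNat] at h
    rw [map_mul]
    exact h
  have hdeg : (f.map (IsLocalRing.residue R)).degree ≠ 0 := by
    rw [hmap, ← one_mul (X ^ 2 : (IsLocalRing.ResidueField R)[X]), ← C_1, degree_quadratic one_ne_zero]
    decide
  obtain ⟨x₀, hx₀⟩ := IsSepClosed.exists_root _ hdeg hsep
  obtain ⟨a₀, rfl⟩ := IsLocalRing.residue_surjective x₀
  -- Hensel: lift the residue root to a root `ρ₁` of `f`
  have h1 : f.eval a₀ ∈ maximalIdeal R := by
    rw [← IsLocalRing.residue_eq_zero_iff, ← eval₂_at_apply, ← eval_map]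
    exact hx₀
  have h2' : IsLocalRing.residue R (f.derivative.eval a₀) ≠ 0 := by
    rw [← eval₂_at_apply, ← eval_map, ← derivative_map]
    exact hsep.eval₂_derivative_ne_zero (RingHom.id _) (by rwa [eval₂_id])
  have h2 : IsUnit (f.derivative.eval a₀) :=
    IsLocalRing.notMem_maximalIdeal.mp (mt (IsLocalRing.residue_eq_zero_iff _).mpr h2')
  obtain ⟨ρ₁, hroot, hρ₁⟩ := HenselianLocalRing.is_henselian f hfm a₀ h1 h2
  refine ⟨ρ₁, -(B * ↑α⁻¹) - ρ₁, fun u F => ?_, ?_⟩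
  · -- Vieta
    have hr : ρ₁ ^ 2 + B * ↑α⁻¹ * ρ₁ + ↑α⁻¹ = 0 := by rw [← hfeval]; exact hroot
    have hsum : (↑α : R) * (ρ₁ + (-(B * ↑α⁻¹) - ρ₁)) = -B := by linear_combination (-B) * hαinv
    have hprod : (↑α : R) * (ρ₁ * (-(B * ↑α⁻¹) - ρ₁)) = 1 := by linear_combination (-(↑α : R)) * hr + hαinv
    linear_combination (u * F) * hsum + (-(F ^ 2)) * hprod
  · -- `ρ₁ − ρ₂ = f'(ρ₁) ≡ f'(a₀) (mod 𝔪)` is a unit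
    have hdiff : ρ₁ - (-(B * ↑α⁻¹) - ρ₁) = f.derivative.eval a₀ + 2 * (ρ₁ - a₀) := by rw [hfder]; ring
    rw [hdiff]
    apply IsLocalRing.notMem_maximalIdeal.mp
    intro hmem
    have hm : f.derivative.eval a₀ ∈ maximalIdeal R := by
      rw [show f.derivative.eval a₀ = f.derivative.eval a₀ + 2 * (ρ₁ - a₀) - 2 * (ρ₁ - a₀) by ring]
      exact Ideal.sub_mem _ hmem (Ideal.mul_mem_left _ (2 : R) hρ₁)
    exact (IsLocalRing.notMem_maximalIdeal.mpr h2) hm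

/-- **§5.3 SUPPORT, global half (Sketch `BinaryQuadricHasZero`, body VERBATIM).** A binary quadratic form over an algebraically
closed field has a non-trivial zero: `(1, 0)` if `c₀ = 0`, else a root of `c₀s² + c₁s + c₂` with `t = 1`. OURS. -/
theorem binaryQuadricHasZero :
    ∀ (k : Type) [Field k] [IsAlgClosed k] (c₀ c₁ c₂ : k),
      ∃ s t : k, (s ≠ 0 ∨ t ≠ 0) ∧ c₀ * s ^ 2 + c₁ * s * t + c₂ * t ^ 2 = 0 := by
  intro k _ _ c₀ c₁ c₂
  by_cases h0 : c₀ = 0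
  · exact ⟨1, 0, Or.inl one_ne_zero, by simp [h0]⟩
  · have hdeg : (C c₀ * X ^ 2 + C c₁ * X + C c₂ : k[X]).degree ≠ 0 := by
      rw [degree_quadratic h0]; decide
    obtain ⟨s, hs⟩ := IsAlgClosed.exists_root _ hdeg
    refine ⟨s, 1, Or.inr one_ne_zero, ?_⟩
    have : c₀ * s ^ 2 + c₁ * s + c₂ = 0 := by
      simpa [eval_add, eval_mul, eval_C, eval_pow, eval_X] using hs
    linear_combination this

-- Mathlib's `IsDiscreteValuationRing O` takes `[IsDomain O]` as a parameter, so the `overlappingInstances` lint (both imply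
-- `Nontrivial`) is unavoidable for the Sketch's DVR binder and is silenced for this statement only (as in the Sketch).
set_option linter.overlappingInstances false in
/-- **§3 INCIDENCE RULE (Sketch `ProperSpecialisationMeets`, body VERBATIM).** Over a DVR, a closed subset of a proper `O`-scheme with
a point over the generic point has a point over the closed point: the image of a closed set under a proper (universally closed)
morphism is closed; it contains the generic point `⊥` of `Spec O`, whose closure is all of `Spec O`. OURS. -/
theorem properSpecialisationMeets :
    ∀ (O : Type) [CommRing O] [IsDomain O] [IsDiscreteValuationRing O]
      (P : AlgebraicGeometry.Scheme.{0}) (q : P ⟶ AlgebraicGeometry.Spec (.of O)),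
      AlgebraicGeometry.IsProper q →
      ∀ Z : TopologicalSpace.Closeds P,
        (∃ z ∈ (Z : Set P), (q.base z).asIdeal = ⊥) →
          ∃ z ∈ (Z : Set P), q.base z = IsLocalRing.closedPoint O := by
  intro O _ _ _ P q hq Z ⟨z, hzZ, hz⟩
  have hcl : IsClosed (q.base '' (Z : Set P)) := q.isClosedMap _ Z.isClosed
  have hsub : closure {q.base z} ⊆ q.base '' (Z : Set P) :=
    closure_minimal (Set.singleton_subset_iff.mpr ⟨z, hzZ, rfl⟩) hcl
  -- the generic point of `Spec O` specialises to every point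
  obtain ⟨x, hx⟩ : ∃ x : PrimeSpectrum O, x = q.base z := ⟨_, rfl⟩
  have hgen : closure ({x} : Set (PrimeSpectrum O)) = Set.univ := by
    rw [PrimeSpectrum.closure_singleton, hx, hz]
    exact PrimeSpectrum.zeroLocus_bot
  have hmem' : (IsLocalRing.closedPoint O) ∈ closure ({x} : Set (PrimeSpectrum O)) := by
    rw [hgen]; exact Set.mem_univ _
  subst hx
  obtain ⟨z', hz', h⟩ := hsub hmem'
  exact ⟨z', hz', h⟩

end Summit.ResolutionOfSingularities.ResolutionOfSingularities.Theorems.EquisingularLift.RegularModelCentres
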